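import Literature.AlgebraicGeometry.HodgeTheory.BettiUniverseAxioms
import Literature.AlgebraicGeometry.Motives.HodgeStructureEndAlgEigenspaces
import HarnessLib

/-!
# Eigenspaces of an algebraic self-map on `Hᵏ(X)`: Hodge blocks and complexification
# (van Geemen 2008 §2 "each `V_σ` is a real Hodge structure"; Voisin I §7.1.1, §7.3.2)

Family `hodge`, layer `Literature/AlgebraicGeometry/HodgeTheory`. PROOF FILE (theorems only: no definition, no named
fact, no instance; D-0026 net debt `0`). For a self-map `σ : X ⟶ X` of a smooth projective variety, `σ^*` is a
morphism of Hodge structures on `Hᵏ(X(ℂ); ℚ)` (Voisin I §7.3.2; the tree's `BettiUniverse.pullHodgeHom`), so every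
eigenspace `E_μ` of `σ^* ⊗ ℂ` on `ℂ ⊗_ℚ Hᵏ(X(ℂ); ℚ)` is the direct sum of its Hodge blocks `E_μ ∩ H^{k−q,q}` (B. van
Geemen, *Real multiplication on K3 surfaces and Kuga–Satake varieties*, Michigan Math. J. 56 (2008), §2: "Since `h`
commutes with `F`, each `V_σ` is a real Hodge structure"; the tree's `HodgeStructure.mem_iSup_eigenspace_inf_piece`,
`iSupIndep_eigenspace_inf_piece`), and the comparison `ℂ ⊗_ℚ Hᵏ(X(ℂ); ℚ) ≅ Hᵏ(X(ℂ); ℂ)` (universal coefficients,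
`ofRatClassBaseChangeEquiv`) carries it onto the eigenspace of `σ^*` on complex cohomology. In the vocabulary of the
light Betti–Hodge universe (`BettiUniverse.pull`, `BettiUniverse.hodge`, `HodgeStructure.piece`):

* `BettiUniverse.hodge_piece_eq_bot_of_lt`, `…_of_neg` — `H^{p,k−p} = 0` off `0 ≤ p ≤ k`.
* **`BettiUniverse.finrank_eigenspace_baseChange_pull_eq_sum`** —
  `dim_ℂ E_μ(σ^* ⊗ ℂ) = Σ_{q ≤ k} dim_ℂ (E_μ(σ^* ⊗ ℂ) ∩ H^{k−q,q}(X))`.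
* **`BettiUniverse.finrank_eigenspace_baseChange_pull_eq_complexBetti`** —
  `dim_ℂ E_μ(σ^* ⊗ ℂ on ℂ ⊗ Hᵏ(X; ℚ)) = dim_ℂ E_μ(σ^* on Hᵏ(X(ℂ); ℂ))`.
* `BettiUniverse.finrank_eigenspace_inf_piece_symm` — `dim (E_μ ∩ H^{p,q}) = dim (E_μ̄ ∩ H^{q,p})` (re-export of the
  tree's `HodgeStructure.finrank_eigenspace_inf_piece_eq` on these carriers).

Written by the prover seat `hodge-nonav-19716-p2` (g5, cell `hodge-nonav`) as step F4 of the discharge, modulo the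
geometric genus, of the binder hV of crux K1-B `VeryGeneralSignCommutatorsInHg` (route
`HodgeConjecture/SignSymmetricPowers`): `b₃^± = Σ_q h^{3−q,q}_±` for the sign involution of a threefold.

## References

* [vanGeemen2008RealMultK3] B. van Geemen, Real multiplication on K3 surfaces and Kuga–Satake varieties, Michigan
  Math. J. 56 (2008), §2 (proof of Thm. ([Z], 2.2.1)).
* [VoisinHodgeI2002] C. Voisin, Hodge Theory and Complex Algebraic Geometry I, CUP 2002, §7.1.1 Def. 7.4, §7.3.2,
  §6.1.3 Cor. 6.13.
* [HatcherAT2002] A. Hatcher, Algebraic Topology, CUP 2002, §3.1 p. 198 (universal coefficients over a field).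
-/

noncomputable section

open CategoryTheory AlgebraicGeometry
open scoped TensorProduct

namespace Literature.AlgebraicGeometry.HodgeTheory

open Literature.AlgebraicGeometry.Motives Literature.AlgebraicGeometry.Motives.HodgeStructure
open Literature.AlgebraicTopology.SingularHomology

variable {n : ℕ} {X : SchemeOver ℂ}

/-! ### Linear algebra: eigenspaces under an intertwining isomorphism -/

/-- An intertwining linear isomorphism `β ∘ A = B ∘ β` maps `ker (A − μ)` onto `ker (B − μ)`; in particular the two
eigenspaces have the same dimension. [folklore] -/
private theorem finrank_eigenspace_eq_of_linearEquiv_conj {K V W : Type*} [Field K] [AddCommGroup V] [Module K V]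
    [AddCommGroup W] [Module K W] (β : V ≃ₗ[K] W) (A : Module.End K V) (B : Module.End K W)
    (h : ∀ v, β (A v) = B (β v)) (μ : K) :
    Module.finrank K ↥(Module.End.eigenspace A μ) = Module.finrank K ↥(Module.End.eigenspace B μ) := by
  have hmap : (Module.End.eigenspace A μ).map (β : V →ₗ[K] W) = Module.End.eigenspace B μ := by
    apply le_antisymm
    · rintro _ ⟨v, hv, rfl⟩
      have hv' : A v = μ • v := Module.End.mem_eigenspace_iff.mp hv
      show (β : V →ₗ[K] W) v ∈ Module.End.eigenspace B μ
      rw [Module.End.mem_eigenspace_iff, LinearEquiv.coe_coe, ← h, hv', map_smul]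
    · intro w hw
      have hw' : B w = μ • w := Module.End.mem_eigenspace_iff.mp hw
      refine ⟨β.symm w, ?_, β.apply_symm_apply w⟩
      show β.symm w ∈ Module.End.eigenspace A μ
      rw [Module.End.mem_eigenspace_iff]
      apply β.injective
      rw [h, β.apply_symm_apply, map_smul, β.apply_symm_apply, hw']
  rw [← hmap]
  exact (LinearEquiv.finrank_map_eq β _).symm

/-! ### The Hodge pieces of `Hᵏ(X)` vanish off `0 ≤ p ≤ k` -/

namespace BettiUniverse

/-- `H^{p,q}(Hᵏ(X)) = 0` for `p > k` (`F^p Hᵏ = 0` beyond the top degree). [cite: VoisinHodgeI2002, §7.1.1 Def. 7.4] -/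
theorem hodge_piece_eq_bot_of_lt (hHD : exists_isReal_hodgeModel) (hX : IsSmoothProjective n X) (k : ℕ)
    {p q : ℤ} (hp : (k : ℤ) < p) : (hodge hHD hX k).piece p q = ⊥ := by
  refine le_bot_iff.mp ((piece_le_F _ p q).trans ?_)
  rw [hodge_F, HodgeModel.ratF_eq_bot _ hX k hp]

/-- `H^{p,q}(Hᵏ(X)) = 0` for `q > k` (conjugate of the previous). [cite: VoisinHodgeI2002, §7.1.1 Def. 7.4] -/
theorem hodge_piece_eq_bot_of_lt_right (hHD : exists_isReal_hodgeModel) (hX : IsSmoothProjective n X) (k : ℕ)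
    {p q : ℤ} (hq : (k : ℤ) < q) : (hodge hHD hX k).piece p q = ⊥ := by
  refine le_bot_iff.mp ((piece_le_complexConj_F _ p q).trans ?_)
  rw [hodge_F, HodgeModel.ratF_eq_bot _ hX k hq, complexConj_bot]

/-! ### `E_μ(σ^* ⊗ ℂ) = ⊕_q (E_μ ∩ H^{k−q,q})` -/

/-- **The eigenspaces of `σ^* ⊗ ℂ` are sums of their Hodge blocks**: for a self-map `σ : X ⟶ X` of a smooth projective
variety and `μ ∈ ℂ`, `dim_ℂ ker (σ^* ⊗ ℂ − μ) = Σ_{q ≤ k} dim_ℂ (ker (σ^* ⊗ ℂ − μ) ∩ H^{k−q,q}(X))` on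
`ℂ ⊗_ℚ Hᵏ(X(ℂ); ℚ)` — `σ^*` is a morphism of Hodge structures (`pullHodgeHom`), so the Hodge components of an
eigenvector are eigenvectors (`HodgeStructure.mem_iSup_eigenspace_inf_piece`), and the blocks are independent
(`iSupIndep_eigenspace_inf_piece`). [cite: vanGeemen2008RealMultK3, §2 (proof of Thm. ([Z], 2.2.1))]
[cite: VoisinHodgeI2002, §7.3.2] -/
theorem finrank_eigenspace_baseChange_pull_eq_sum (hHD : exists_isReal_hodgeModel)
    (hI : hodgePQ_independent_of_hodgeModel) (hX : IsSmoothProjective n X) (σ : X ⟶ X) (k : ℕ) (μ : ℂ) :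
    Module.finrank ℂ ↥(Module.End.eigenspace ((pull σ k).baseChange ℂ) μ) =
      ∑ q ∈ Finset.range (k + 1), Module.finrank ℂ
        ↥(Module.End.eigenspace ((pull σ k).baseChange ℂ) μ ⊓ (hodge hHD hX k).piece ((k : ℤ) - q) q) := by
  classical
  haveI : Module.Finite ℚ ↥(bettiCohomology X k) := finite hX k
  set H := hodge hHD hX k with hHdef
  set E := Module.End.eigenspace ((pull σ k).baseChange ℂ) μ with hE
  -- `σ^*` lies in `End_Hdg`
  have hmem : pull σ k ∈ H.endAlg := (pullHodgeHom hHD hI hX hX σ k).toLinearMap_mem_endAlg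
  -- the blocks, indexed by `q ∈ Fin (k+1)` (`p = k − q`)
  set B : Fin (k + 1) → Submodule ℂ (ℂ ⊗[ℚ] ↥(bettiCohomology X k)) :=
    fun q ↦ E ⊓ H.piece ((k : ℤ) - q) q with hB
  -- independence: a sub-family of the `(μ, p)`-blocks
  have hind : iSupIndep B := by
    have h := iSupIndep_eigenspace_inf_piece H ((pull σ k).baseChange ℂ)
    have hB' : B = (fun l : ℂ × ℤ ↦ Module.End.eigenspace ((pull σ k).baseChange ℂ) l.1 ⊓ H.piece l.2 ((k : ℤ) - l.2)) ∘
        fun q : Fin (k + 1) ↦ (μ, (k : ℤ) - q) := by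
      funext q
      simp only [hB, hE, Function.comp_apply, sub_sub_cancel]
    rw [hB']
    exact h.comp fun q q' hqq' ↦ by
      simp only [Prod.mk.injEq, true_and] at hqq'
      exact Fin.ext (by omega)
  -- spanning: `E = ⨆ B`
  have hsup : ⨆ q, B q = E := by
    apply le_antisymm (iSup_le fun q ↦ inf_le_left)
    intro x hx
    have hx' := mem_iSup_eigenspace_inf_piece H ⟨pull σ k, hmem⟩ (μ := μ) (x := x) hx
    have hle : (⨆ p : ℤ, Module.End.eigenspace ((pull σ k).baseChange ℂ) μ ⊓ H.piece p ((k : ℤ) - p)) ≤ ⨆ q, B q := by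
      refine iSup_le fun p ↦ ?_
      by_cases hp0 : p < 0
      · rw [hHdef, hodge_piece_eq_bot_of_lt_right hHD hX k (by omega), inf_bot_eq]; exact bot_le
      by_cases hpk : (k : ℤ) < p
      · rw [hHdef, hodge_piece_eq_bot_of_lt hHD hX k hpk, inf_bot_eq]; exact bot_le
      · have hq : ((k : ℤ) - p).toNat < k + 1 := by omega
        refine le_trans (le_of_eq ?_) (le_iSup B ⟨((k : ℤ) - p).toNat, hq⟩)
        simp only [hB, hE]
        congr 2 <;> omega
    exact hle hx'
  haveI : ∀ q, Module.Finite ℂ ↥(B q) := fun q ↦ inferInstance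
  -- `dim E = Σ dim B q`
  have hdim : Module.finrank ℂ ↥(⨆ q, B q) = ∑ q, Module.finrank ℂ ↥(B q) := by
    have hinj := hind.dfinsupp_lsum_injective
    have hrange : LinearMap.range (DFinsupp.lsum ℕ (M := fun q => ↥(B q)) fun q => (B q).subtype) = ⨆ q, B q :=
      (Submodule.iSup_eq_range_dfinsupp_lsum B).symm
    rw [← hrange, LinearMap.finrank_range_of_inj hinj, ← Module.finrank_directSum]
    rfl
  calc Module.finrank ℂ ↥E = Module.finrank ℂ ↥(⨆ q, B q) := by rw [hsup]
    _ = ∑ q, Module.finrank ℂ ↥(B q) := hdim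
    _ = _ := by rw [Finset.sum_range]

/-! ### Complexification: `ℂ ⊗_ℚ Hᵏ(X(ℂ); ℚ) ≅ Hᵏ(X(ℂ); ℂ)` intertwines `σ^* ⊗ ℂ` with `σ^*` -/

/-- **The eigenspaces of `σ^* ⊗ ℂ` on `ℂ ⊗_ℚ Hᵏ(X(ℂ); ℚ)` and of `σ^*` on `Hᵏ(X(ℂ); ℂ)` have the same dimension**:
the universal-coefficients isomorphism `β = ofRatClassBaseChangeEquiv` is natural (`ofRatClassBaseChange_baseChange_map`).
[cite: HatcherAT2002, §3.1 p. 198] [cite: VoisinHodgeI2002, §7.3.2] -/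
theorem finrank_eigenspace_baseChange_pull_eq_complexBetti (hX : IsSmoothProjective n X) (σ : X ⟶ X) (k : ℕ) (μ : ℂ) :
    Module.finrank ℂ ↥(Module.End.eigenspace ((pull σ k).baseChange ℂ) μ) =
      Module.finrank ℂ ↥(Module.End.eigenspace (complexBetti.map σ k).hom μ) := by
  refine finrank_eigenspace_eq_of_linearEquiv_conj (ofRatClassBaseChangeEquiv hX k) _ _ (fun v ↦ ?_) μ
  rw [ofRatClassBaseChangeEquiv_apply, ofRatClassBaseChangeEquiv_apply]
  exact HodgeModel.ofRatClassBaseChange_baseChange_map σ k v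

/-- **Hodge symmetry of the eigen-blocks** on these carriers: `dim (E_μ(σ^* ⊗ ℂ) ∩ H^{p,q}) =
dim (E_μ̄(σ^* ⊗ ℂ) ∩ H^{q,p})` (complex conjugation; the tree's `HodgeStructure.finrank_eigenspace_inf_piece_eq` for the
rational endomorphism `σ^*`). [cite: vanGeemen2008RealMultK3, §2] [cite: VoisinHodgeI2002, §7.1.1 Def. 7.4] -/
theorem finrank_eigenspace_inf_piece_symm (hHD : exists_isReal_hodgeModel) (hX : IsSmoothProjective n X)
    (σ : X ⟶ X) (k : ℕ) (μ : ℂ) (p q : ℤ) :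
    Module.finrank ℂ ↥(Module.End.eigenspace ((pull σ k).baseChange ℂ) μ ⊓ (hodge hHD hX k).piece p q) =
      Module.finrank ℂ ↥(Module.End.eigenspace ((pull σ k).baseChange ℂ) (starRingEnd ℂ μ) ⊓
        (hodge hHD hX k).piece q p) := by
  haveI : Module.Finite ℚ ↥(bettiCohomology X k) := finite hX k
  exact HodgeStructure.finrank_eigenspace_inf_piece_eq (hodge hHD hX k) (pull σ k) μ p q

end BettiUniverse

end Literature.AlgebraicGeometry.HodgeTheory

end
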